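import Mathlib
import HarnessLib
import Summits.QuantumAdvantage.QuantumAdvantage.Theses.AmplitudeProofs
import Literature.Computability.MetaComplexity.ProofSystemsProofs
import Literature.Computability.Complexity.Promise
import Literature.Computability.Complexity.Counting
import Literature.Computability.Complexity.LengthCompare
import Literature.Computability.Complexity.StringCopy
import Literature.Computability.Cryptography.ClassBQP

/-!
# Birth skeleton for piece X₁ `ApcPolyBounded` (split `np-cut` of crux `ApcThesis`, stmt-QuantumAdvantage-2697)

Piece X₁ = the Cook–Reckhow form of `PromiseBQP ⊆ PromiseNP` (sound poly-time amplitude verifier with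
polynomially short proofs on the `2/3`-promise).  Line "GapP dictionary + classical certification"
(Fortnow–Rogers 1999 §3 transplanted to the promise level):

* `stub_apcGapFunction` (TRUE in print; tree pattern `BQP_subset_AWPP_holds`, `BQPSubsetAWPPCount.exists_gapPair`,
  Adleman–DeMarrais–Huang path-pair counts for Clifford+T): the gap-acceptance promise problem of oracle-free
  Clifford+T circuits is in textbook promise-AWPP — ONE `GapP` function `g` and a polynomial `p` with
  `g(s)/2^{p|s|} ∈ [2/3,1]` when `Pr[C accepts x] ≥ 2/3` and `∈ [0,1/3]` when `≤ 1/3` (`s = ⟨⟨C⟩,x⟩`);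
  the quantum content of X₁ is exhausted here;
* `stub_promiseAWPP_subset_promiseNP` (OPEN, purely classical counting statement; the residue of X₁):
  textbook promise-AWPP ⊆ PromiseNP ("GapP gap-values have short certificates");
* `ApcPolyBounded_of` (kernel-checked): monotonicity of promise classes + the Cook–Reckhow translation
  NP-separator ↦ verifier with the witness-length test built in (`LenLe p ⊓ L' ∈ P`, tree pattern
  `hasPolyBoundedProofSystem_iff_mem_NP_holds`, ←).
Sources: FortnowRogers1999 Thm 3.1/Lemma 3.2; Fenner2003 Cor 3.2; CookReckhow1979 Prop 1.4; Goldreich2006 Def 1.3.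
-/

set_option linter.dupNamespace false

namespace Summit.QuantumAdvantage.QuantumAdvantage.Cruxes.ApcThesis.NpCut.PolyBounded

open _root_.Computability Literature.Computability.Complexity Literature.Computability.Complexity.Classes
  Literature.Computability.Complexity.Nondeterministic Literature.Computability.MetaComplexity
  Literature.Computability.Cryptography

/-- **stub 1 (TRUE in print).** The gap-acceptance promise problem is in textbook promise-AWPP, written out. -/
theorem stub_apcGapFunction : ∃ g ∈ Literature.Computability.Complexity.GapP, ∃ p : Polynomial ℕ, ∀ (n m : ℕ) (C : Literature.Computability.Cryptography.QCircuit Literature.Computability.Cryptography.cliffordT (n + m)) (x : Literature.Computability.Cryptography.QReg n), C.IsOracleFree → ((2 : ℝ) / 3 ≤ C.acceptProb 0 x → 2 * (2 : ℤ) ^ p.eval (Literature.Computability.Complexity.boolPair (Literature.Computability.Cryptography.QCircuit.sigmaEncode ⟨n, m, C⟩) (List.ofFn x)).length ≤ 3 * g (Literature.Computability.Complexity.boolPair (Literature.Computability.Cryptography.QCircuit.sigmaEncode ⟨n, m, C⟩) (List.ofFn x)) ∧ g (Literature.Computability.Complexity.boolPair (Literature.Computability.Cryptography.QCircuit.sigmaEncode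 ⟨n, m, C⟩) (List.ofFn x)) ≤ (2 : ℤ) ^ p.eval (Literature.Computability.Complexity.boolPair (Literature.Computability.Cryptography.QCircuit.sigmaEncode ⟨n, m, C⟩) (List.ofFn x)).length) ∧ (C.acceptProb 0 x ≤ (1 : ℝ) / 3 → 0 ≤ g (Literature.Computability.Complexity.boolPair (Literature.Computability.Cryptography.QCircuit.sigmaEncode ⟨n, m, C⟩) (List.ofFn x)) ∧ 3 * g (Literature.Computability.Complexity.boolPair (Literature.Computability.Cryptography.QCircuit.sigmaEncode ⟨n, m, C⟩) (List.ofFn x)) ≤ (2 : ℤ) ^ p.eval (Literature.Computability.Complexity.boolPair (Literature.Computability.Cryptography.QCircuit.sigmaEncode ⟨n, m, C⟩) (List.ofFn x)).length) := by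
  sorry

/-- **stub 2 (OPEN, classical).** Textbook promise-AWPP ⊆ PromiseNP. -/
theorem stub_promiseAWPP_subset_promiseNP : ∀ Q : Literature.Computability.Complexity.PromiseProblem, (∃ g ∈ Literature.Computability.Complexity.GapP, ∃ p : Polynomial ℕ, (∀ x ∈ Q.yes, 2 * (2 : ℤ) ^ p.eval x.length ≤ 3 * g x ∧ g x ≤ (2 : ℤ) ^ p.eval x.length) ∧ (∀ x ∈ Q.no, 0 ≤ g x ∧ 3 * g x ≤ (2 : ℤ) ^ p.eval x.length)) → Q ∈ Literature.Computability.Complexity.PromiseNP := by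
  sorry

/-- The gap-acceptance promise problem of oracle-free Clifford+T circuits. -/
def apcPromise : PromiseProblem where
  yes := {s | ∃ (n m : ℕ) (C : QCircuit cliffordT (n + m)) (x : QReg n), C.IsOracleFree ∧
    s = boolPair (QCircuit.sigmaEncode ⟨n, m, C⟩) (List.ofFn x) ∧ (2 : ℝ) / 3 ≤ C.acceptProb 0 x}
  no := {s | ∃ (n m : ℕ) (C : QCircuit cliffordT (n + m)) (x : QReg n), C.IsOracleFree ∧
    s = boolPair (QCircuit.sigmaEncode ⟨n, m, C⟩) (List.ofFn x) ∧ C.acceptProb 0 x ≤ (1 : ℝ) / 3}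

/-- From the two stubs: the gap-acceptance promise problem has an `NP` separator. -/
theorem apcPromise_mem_PromiseNP_of (h₁ : ∃ g ∈ Literature.Computability.Complexity.GapP, ∃ p : Polynomial ℕ, ∀ (n m : ℕ) (C : Literature.Computability.Cryptography.QCircuit Literature.Computability.Cryptography.cliffordT (n + m)) (x : Literature.Computability.Cryptography.QReg n), C.IsOracleFree → ((2 : ℝ) / 3 ≤ C.acceptProb 0 x → 2 * (2 : ℤ) ^ p.eval (Literature.Computability.Complexity.boolPair (Literature.Computability.Cryptography.QCircuit.sigmaEncode ⟨n, m, C⟩) (List.ofFn x)).length ≤ 3 * g (Literature.Computability.Complexity.boolPair (Literature.Computability.Cryptography.QCircuit.sigmaEncode ⟨n, m, C⟩) (List.ofFn x)) ∧ g (Literature.Computability.Complexity.boolPair (Literature.Computability.Cryptography.QCircuit.sigmaEncode ⟨n, m, C⟩) (List.ofFn x)) ≤ (2 : ℤ) ^ p.eval (Literature.Computability.Complexity.boolPair (Literature.Computability.Cryptography.QCircuit.sigmaEncode ⟨n, m, C⟩) (List.ofFn x)).length) ∧ (C.acceptProb 0 x ≤ (1 : ℝ) / 3 → 0 ≤ g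 (Literature.Computability.Complexity.boolPair (Literature.Computability.Cryptography.QCircuit.sigmaEncode ⟨n, m, C⟩) (List.ofFn x)) ∧ 3 * g (Literature.Computability.Complexity.boolPair (Literature.Computability.Cryptography.QCircuit.sigmaEncode ⟨n, m, C⟩) (List.ofFn x)) ≤ (2 : ℤ) ^ p.eval (Literature.Computability.Complexity.boolPair (Literature.Computability.Cryptography.QCircuit.sigmaEncode ⟨n, m, C⟩) (List.ofFn x)).length)) (h₂ : ∀ Q : Literature.Computability.Complexity.PromiseProblem, (∃ g ∈ Literature.Computability.Complexity.GapP, ∃ p : Polynomial ℕ, (∀ x ∈ Q.yes, 2 * (2 : ℤ) ^ p.eval x.length ≤ 3 * g x ∧ g x ≤ (2 : ℤ) ^ p.eval x.length) ∧ (∀ x ∈ Q.no, 0 ≤ g x ∧ 3 * g x ≤ (2 : ℤ) ^ p.eval x.length)) → Q ∈ Literature.Computability.Complexity.PromiseNP) : apcPromise ∈ PromiseNP := by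
  obtain ⟨g, hg, p, hgp⟩ := h₁
  refine h₂ apcPromise ⟨g, hg, p, ?_, ?_⟩
  · rintro s ⟨n, m, C, x, hC, rfl, hacc⟩
    exact (hgp n m C x hC).1 hacc
  · rintro s ⟨n, m, C, x, hC, rfl, hacc⟩
    exact (hgp n m C x hC).2 hacc

/-- **Cook–Reckhow translation** (Prop. 1.4 pattern, NP-separator ↦ sound verifier with short proofs):
an `NP` language separating the gap-acceptance promise gives piece X₁. -/
theorem apcPolyBounded_of_mem_PromiseNP (h : apcPromise ∈ PromiseNP) : ∃ V : List Bool → List Bool → Bool, Literature.Computability.MetaComplexity.IsPolyTimeVerifier V ∧ (∀ (n m : ℕ) (C : Literature.Computability.Cryptography.QCircuit Literature.Computability.Cryptography.cliffordT (n + m)) (x : Literature.Computability.Cryptography.QReg n) (π : List Bool), C.IsOracleFree → V (Literature.Computability.Complexity.boolPair (Literature.Computability.Cryptography.QCircuit.sigmaEncode ⟨n, m, C⟩) (List.ofFn x)) π = true → (1 : ℝ) / 3 < C.acceptProb 0 x) ∧ ∃ p : Polynomial ℕ, ∀ (n m : ℕ) (C : Literature.Computability.Cryptography.QCircuit Literature.Computability.Cryptography.cliffordT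 (n + m)) (x : Literature.Computability.Cryptography.QReg n), C.IsOracleFree → (2 : ℝ) / 3 ≤ C.acceptProb 0 x → ∃ π : List Bool, π.length ≤ p.eval (Literature.Computability.Complexity.boolPair (Literature.Computability.Cryptography.QCircuit.sigmaEncode ⟨n, m, C⟩) (List.ofFn x)).length ∧ V (Literature.Computability.Complexity.boolPair (Literature.Computability.Cryptography.QCircuit.sigmaEncode ⟨n, m, C⟩) (List.ofFn x)) π = true := by
  obtain ⟨L₁, hL₁, hyes, hno⟩ := h
  obtain ⟨L', hL', p, hp⟩ := hL₁
  set W : Language Bool := LenLe p ⊓ L' with hW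
  have hWP : W ∈ P := inter_mem_P (LenLe_mem_P p) hL'
  have hmemW : ∀ x π : List Bool, boolPair x π ∈ W ↔ π.length ≤ p.eval x.length ∧ boolPair x π ∈ L' :=
    fun x π => by
      change boolPair x π ∈ LenLe p ∧ boolPair x π ∈ L' ↔ _
      rw [boolPair_mem_LenLe]
  -- the verifier with the length test built in
  let V : List Bool → List Bool → Bool := fun x π => W.boolIndicator (boolPair x π)
  have hVtrue : ∀ x π, V x π = true ↔ boolPair x π ∈ W := fun x π =>
    (Set.mem_iff_boolIndicator W (boolPair x π)).symm
  obtain ⟨q, M, hM⟩ := polyTimeDecidable_iff.1 (mem_P_iff_holds.1 hWP)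
  refine ⟨V, ⟨q, M, fun pr => hM (boolPair pr.1 pr.2)⟩, ?_, p, ?_⟩
  · intro n m C x π hC hVacc
    have hw := (hmemW _ π).1 ((hVtrue _ π).1 hVacc)
    have hL : boolPair (QCircuit.sigmaEncode ⟨n, m, C⟩) (List.ofFn x) ∈ L₁ := (hp _).2 ⟨π, hw.1, hw.2⟩
    by_contra hle
    exact hno ⟨n, m, C, x, hC, rfl, not_lt.1 hle⟩ hL
  · intro n m C x hC hacc
    obtain ⟨π, hlen, hπ⟩ := (hp _).1 (hyes ⟨n, m, C, x, hC, rfl, hacc⟩)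
    exact ⟨π, hlen, (hVtrue _ π).2 ((hmemW _ π).2 ⟨hlen, hπ⟩)⟩

/-- **Composition of the birth line** (kernel-checked): piece X₁ (stated verbatim; after the split it is the route
decl `Theses.AmplitudeProofs.ApcPolyBounded`) from the two stubs BY NAME. -/
theorem ApcPolyBounded_of : ∃ V : List Bool → List Bool → Bool, Literature.Computability.MetaComplexity.IsPolyTimeVerifier V ∧ (∀ (n m : ℕ) (C : Literature.Computability.Cryptography.QCircuit Literature.Computability.Cryptography.cliffordT (n + m)) (x : Literature.Computability.Cryptography.QReg n) (π : List Bool), C.IsOracleFree → V (Literature.Computability.Complexity.boolPair (Literature.Computability.Cryptography.QCircuit.sigmaEncode ⟨n, m, C⟩) (List.ofFn x)) π = true → (1 : ℝ) / 3 < C.acceptProb 0 x) ∧ ∃ p : Polynomial ℕ, ∀ (n m : ℕ) (C : Literature.Computability.Cryptography.QCircuit Literature.Computability.Cryptography.cliffordT (n + m)) (x : Literature.Computability.Cryptography.QReg n), C.IsOracleFree → (2 : ℝ) / 3 ≤ C.acceptProb 0 x → ∃ π : List Bool, π.length ≤ p.eval (Literature.Computability.Complexity.boolPair (Literature.Computability.Cryptography.QCircuit.sigmaEncode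 ⟨n, m, C⟩) (List.ofFn x)).length ∧ V (Literature.Computability.Complexity.boolPair (Literature.Computability.Cryptography.QCircuit.sigmaEncode ⟨n, m, C⟩) (List.ofFn x)) π = true :=
  apcPolyBounded_of_mem_PromiseNP (apcPromise_mem_PromiseNP_of stub_apcGapFunction stub_promiseAWPP_subset_promiseNP)

end Summit.QuantumAdvantage.QuantumAdvantage.Cruxes.ApcThesis.NpCut.PolyBounded
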